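import Mathlib
import Literature.NumberTheory.LFunctions.Zhang2022.TypedSection10B
import Literature.NumberTheory.LFunctions.Zhang2022.Section10RangeToolkit
import Literature.NumberTheory.LFunctions.Zhang2022.Section8FrontEnd810
import HarnessLib

/-!
# Zhang (2022) §10, evaluation of `Θ₁(𝐚₁₃,𝐚₂₁)`, middle range `P^{0.5} ≤ dr < P^{0.502}`
# (node `Z22:§10.u043`, first line): the EXACT layer

Topic `Literature/NumberTheory/LFunctions/Zhang2022` (Landau–Siegel audit tree; verdict-neutral).
Y. Zhang, *Discrete mean estimates and the Landau–Siegel zero*, arXiv:2211.02515v1 (2022)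
[Zhang2022LandauSiegel], §10 p. 58, tex L2980–L2990 — **an unrefereed manuscript under
adjudication; nothing here bears on its Theorems 1–2.** The typed node `Typed.Sec10B.Eq1043a`
("the sum over `P^{0.5} ≤ dr < P^{0.502}` is equal to
`(500L′(1,χ)²/(0.504 log²P))Σ_{P^{0.5}≤n<P^{0.502}} |χ(n)|λ₀ⱼ(n)φ(n)⁻¹(−1 − β_j log(n/P^{0.5}))𝔤_{j6}(P^{0.504}/n) + o(α)`")
is a consequence of Lemma 10.1 ((10.3), (10.5)), Lemma 8.4 (`μ = 6`) and the arithmetic identity (8.10).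
This file proves the EXACT identities of that deduction (no estimate yet):

* `mSum13_eq_frakv1` — the `m`-sum of `S_j(𝐚₁₃,𝐚₂₁)` at `y = dr ≥ P^{0.5}` IS `𝔳₁ⱼ(dr)` of
  Lemma 10.1 (the two truncations agree on the support of `f̃`);
* `nSum21_eq` — for `P^{0.5} ≤ dr < P^{0.502}` the `n`-sum IS `(log P₁)⁻¹ ×` the left side of
  Lemma 8.4 at `x = P₁/(dr)`, `μ = 6` (`ϰ₂(drn) = 0` since `drn ≥ P^{0.5} ≥ P₂`;
  `conj ϰ₁(drn) = [n < x](x/n)^{−β₆}log(x/n)/log P₁`, `β₆ ∈ iℝ`);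
* `drSum_eq_sum_divisors`, `sum_divisors_drWeight_mul_PiW` — "substituting `n = dr`" and the
  collapse `Σ_{dr=n}|χ(d)||μχ(r)|λ₀ⱼ(dr)Π(d,r)/(drφ(r)) = |χ(n)|λ₀ⱼ(n)/φ(n)` ((8.10), tree
  `Section8FrontEnd810.eq810_holds`);
* `drSum_sub_main_eq` — hence `(middle-range sum) − (printed main term)` EQUALS the weighted sum
  of the products' deviations from their main values, which `Section10Range1321Mid` then bounds.

## References

* Y. Zhang, arXiv:2211.02515v1 (2022), §10 p. 58; §8 (8.10), Lemma 8.4; §10 Lemma 10.1.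
  [cite: Zhang2022LandauSiegel, §10 p. 58]
-/

noncomputable section

open Complex Real Finset ComplexConjugate

namespace Literature.NumberTheory.LFunctions.Zhang2022.Sj1321Mid

open Skeleton Typed.Sec10B

variable (c' : ℝ) {D : ℕ}

/-! ## §1. Parameters: `P = e^{𝓛⁹}`, `T = e^{𝓛^{1.1}}`, `P₁ = P^{0.504}`, `P₂ = P^{0.5}T⁻¹⁰` -/

/-- `P^z = e^{𝓛⁹z}`. [cite: Zhang2022LandauSiegel, §2 (2.6)] -/
theorem bigP_rpow_eq (D : ℕ) (z : ℝ) : bigP D ^ z = Real.exp (ell D ^ 9 * z) := by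
  rw [bigP, ← Real.exp_mul]

/-- `P > 0`. [cite: Zhang2022LandauSiegel, §2 (2.6)] -/
private theorem bigP_pos' (D : ℕ) : 0 < bigP D := Real.exp_pos _

/-- `T ≥ 1`. [cite: Zhang2022LandauSiegel, §6 p. 30] -/
theorem one_le_bigT (D : ℕ) (hL : 0 ≤ ell D) : 1 ≤ bigT D :=
  Real.one_le_exp (Real.rpow_nonneg hL _)

/-- `T = e^{𝓛^{1.1}} ≤ e^{𝓛²}` for `𝓛 ≥ 1`. [cite: Zhang2022LandauSiegel, §6 p. 30] -/
theorem bigT_le_exp_sq (hL : 1 ≤ ell D) : bigT D ≤ Real.exp (ell D ^ 2) := by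
  rw [Skeleton.bigT]
  refine Real.exp_le_exp.mpr ?_
  have h := Real.rpow_le_rpow_of_exponent_le hL (show (1.1 : ℝ) ≤ 2 by norm_num)
  rwa [Real.rpow_two] at h

/-- For `𝓛 ≥ 3`: `T² · P^{0.502} ≤ P` (so `dr < P^{0.502} ⇒ dr < PT⁻²`) — from `2𝓛² ≤ 0.498𝓛⁹`.
[cite: Zhang2022LandauSiegel, §10 p. 58] -/
theorem bigT_sq_mul_rpow_le (hL : 3 ≤ ell D) :
    bigT D ^ 2 * bigP D ^ (0.502 : ℝ) ≤ bigP D := by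
  have hL1 : 1 ≤ ell D := by linarith
  have hT := bigT_le_exp_sq (D := D) hL1
  have hT0 : 0 ≤ bigT D := (Real.exp_pos _).le
  have hP0 : 0 ≤ bigP D ^ (0.502 : ℝ) := Real.rpow_nonneg (bigP_pos' D).le _
  have h7 : (3 : ℝ) ^ 7 ≤ ell D ^ 7 := pow_le_pow_left₀ (by norm_num) hL 7
  calc bigT D ^ 2 * bigP D ^ (0.502 : ℝ)
      ≤ Real.exp (ell D ^ 2) ^ 2 * bigP D ^ (0.502 : ℝ) := by
        gcongr
    _ = Real.exp (2 * ell D ^ 2 + ell D ^ 9 * 0.502) := by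
        rw [bigP_rpow_eq, ← Real.exp_nat_mul, ← Real.exp_add]; norm_num
    _ ≤ Real.exp (ell D ^ 9) := by
        refine Real.exp_le_exp.mpr ?_
        nlinarith
    _ = bigP D := by rw [bigP]

/-- For `𝓛 ≥ 3`: `T² · P^{0.004} ≤ P` (so `⌈P₁/(dr)⌉ ≤ ⌈PT⁻²⌉` for `dr ≥ P^{0.5}`).
[cite: Zhang2022LandauSiegel, §10 p. 58] -/
theorem bigT_sq_mul_rpow_le' (hL : 3 ≤ ell D) :
    bigT D ^ 2 * bigP D ^ (0.004 : ℝ) ≤ bigP D := by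
  have h1 : bigP D ^ (0.004 : ℝ) ≤ bigP D ^ (0.502 : ℝ) :=
    Real.rpow_le_rpow_of_exponent_le (Real.one_le_exp (by positivity)) (by norm_num)
  have hT0 : 0 ≤ bigT D ^ 2 := sq_nonneg _
  exact (mul_le_mul_of_nonneg_left h1 hT0).trans (bigT_sq_mul_rpow_le hL)

/-- For `𝓛 ≥ 3`: `T · P^{0.502} ≤ P^{0.504}` (so `x = P₁/(dr) > T` for `dr < P^{0.502}`).
[cite: Zhang2022LandauSiegel, §10 p. 58] -/
theorem bigT_mul_rpow_le (hL : 3 ≤ ell D) :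
    bigT D * bigP D ^ (0.502 : ℝ) ≤ bigP D ^ (0.504 : ℝ) := by
  have hL1 : 1 ≤ ell D := by linarith
  have h7 : (3 : ℝ) ^ 7 ≤ ell D ^ 7 := pow_le_pow_left₀ (by norm_num) hL 7
  have hP0 : 0 ≤ bigP D ^ (0.502 : ℝ) := Real.rpow_nonneg (bigP_pos' D).le _
  calc bigT D * bigP D ^ (0.502 : ℝ) ≤ Real.exp (ell D ^ 2) * bigP D ^ (0.502 : ℝ) := by
        have := bigT_le_exp_sq (D := D) hL1
        gcongr
    _ = Real.exp (ell D ^ 2 + ell D ^ 9 * 0.502) := by rw [bigP_rpow_eq, ← Real.exp_add]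
    _ ≤ Real.exp (ell D ^ 9 * 0.504) := Real.exp_le_exp.mpr (by nlinarith)
    _ = bigP D ^ (0.504 : ℝ) := (bigP_rpow_eq D _).symm

/-- `P₂ ≤ P^{0.5}`. [cite: Zhang2022LandauSiegel, §2 (2.21)] -/
theorem P2_le_rpow_half (hL : 0 ≤ ell D) : Skeleton.P2 D ≤ bigP D ^ (0.5 : ℝ) := by
  rw [Skeleton.P2]
  exact div_le_self (Real.rpow_nonneg (bigP_pos' D).le _)
    (one_le_pow₀ (one_le_bigT D hL))

/-- `⌈PT⁻²⌉ ≤ ⌈P⌉`. [cite: Zhang2022LandauSiegel, §7 (7.2)] -/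
theorem Nsupp_le_ceil_bigP (hL : 0 ≤ ell D) : Nsupp D ≤ ⌈bigP D⌉₊ :=
  Nat.ceil_mono (div_le_self (bigP_pos' D).le (one_le_pow₀ (one_le_bigT D hL)))

/-- The middle range sits below the support bound: `n < P^{0.502} ⇒ n < ⌈PT⁻²⌉`.
[cite: Zhang2022LandauSiegel, §10 p. 58] -/
theorem lt_Nsupp_of_lt_rpow (hL : 3 ≤ ell D) {n : ℕ} (hn : (n : ℝ) < bigP D ^ (0.502 : ℝ)) :
    n < Nsupp D := by
  have hT1 : 1 ≤ bigT D ^ 2 := one_le_pow₀ (one_le_bigT D (by linarith))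
  have h : (n : ℝ) < bigP D / bigT D ^ 2 := by
    rw [lt_div_iff₀ (by positivity)]
    calc (n : ℝ) * bigT D ^ 2 < bigP D ^ (0.502 : ℝ) * bigT D ^ 2 := by gcongr
      _ ≤ bigP D := by rw [mul_comm]; exact bigT_sq_mul_rpow_le hL
  rw [Nsupp]
  exact Nat.lt_ceil.mpr h

/-! ## §2. The `m`-sum is `𝔳₁ⱼ(dr)` -/

/-- For `y ≥ P^{0.5}` (a natural number), the `m`-sum of `S_j(𝐚₁₃,𝐚₂₁)` (truncated at `⌈PT⁻²⌉`
like `S_j`) equals `𝔳₁ⱼ(y)` of Lemma 10.1 (truncated at `⌈P⌉`): the extra terms have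
`ym ≥ P^{0.5}·PT⁻² > P^{0.504}`, where `f̃(log(ym)/log P) = 0`. [cite: Zhang2022LandauSiegel, §10 p. 58] -/
theorem mSum13_eq_frakv1 (χ : DirichletCharacter ℂ D) (hL : 3 ≤ ell D) (j : ℕ) {y : ℕ}
    (hy : bigP D ^ (0.5 : ℝ) ≤ (y : ℝ)) :
    mSum13 c' χ j y = frakv1 c' χ j (y : ℝ) := by
  have hL0 : 0 ≤ ell D := by linarith
  unfold mSum13 frakv1
  have hcast : ∀ m : ℕ, (((y * m : ℕ) : ℝ)) = (y : ℝ) * (m : ℝ) := fun m => by push_cast; ring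
  simp_rw [hcast]
  refine Finset.sum_subset (Finset.Ico_subset_Ico_right (Nsupp_le_ceil_bigP hL0)) ?_
  intro m hmP hmN
  rw [Finset.mem_Ico] at hmP
  rw [Finset.mem_Ico, not_and, not_lt] at hmN
  have hm : Nsupp D ≤ m := hmN hmP.1
  -- `y * m ≥ P^{0.5} · P/T² > P^{0.504}`, so `log(ym)/log P > 0.504`
  have hmR : bigP D / bigT D ^ 2 ≤ (m : ℝ) := (Nat.le_ceil _).trans (by exact_mod_cast hm)
  have h504 : 0 < bigP D ^ (0.504 : ℝ) * Real.exp 1 :=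
    mul_pos (Real.rpow_pos_of_pos (bigP_pos' D) _) (Real.exp_pos 1)
  have hPT : bigP D ^ (0.504 : ℝ) * Real.exp 1 ≤ bigP D ^ (0.5 : ℝ) * (bigP D / bigT D ^ 2) := by
    have hL1 : 1 ≤ ell D := by linarith
    have hT := bigT_le_exp_sq (D := D) hL1
    have hT0 : 0 < bigT D := Real.exp_pos _
    have h7 : (3 : ℝ) ^ 7 ≤ ell D ^ 7 := pow_le_pow_left₀ (by norm_num) hL 7
    rw [← mul_div_assoc, le_div_iff₀ (pow_pos hT0 2)]
    calc bigP D ^ (0.504 : ℝ) * Real.exp 1 * bigT D ^ 2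
        ≤ bigP D ^ (0.504 : ℝ) * Real.exp 1 * Real.exp (ell D ^ 2) ^ 2 := by gcongr
      _ = Real.exp (ell D ^ 9 * 0.504 + 1 + 2 * ell D ^ 2) := by
          rw [bigP_rpow_eq, ← Real.exp_add, ← Real.exp_nat_mul, ← Real.exp_add]; norm_num
      _ ≤ Real.exp (ell D ^ 9 * 0.5 + ell D ^ 9) := Real.exp_le_exp.mpr (by nlinarith)
      _ = bigP D ^ (0.5 : ℝ) * bigP D := by rw [Real.exp_add, bigP_rpow_eq, bigP]
  have hym : bigP D ^ (0.504 : ℝ) * Real.exp 1 ≤ (y : ℝ) * m :=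
    hPT.trans (mul_le_mul hy hmR (div_nonneg (bigP_pos' D).le (sq_nonneg _))
      (Nat.cast_nonneg y))
  have hpos : 0 < (y : ℝ) * m := lt_of_lt_of_le h504 hym
  have hlog : 0.504 * Real.log (bigP D) + 1 ≤ Real.log ((y : ℝ) * m) := by
    have := Real.log_le_log h504 hym
    rwa [Real.log_mul (Real.rpow_pos_of_pos (bigP_pos' D) _).ne' (Real.exp_pos _).ne',
      Real.log_rpow (bigP_pos' D), Real.log_exp] at this
  have hlogP : 0 < Real.log (bigP D) := by rw [bigP, Real.log_exp]; positivity
  have hz : 0.504 < Real.log ((y : ℝ) * m) / Real.log (bigP D) := by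
    rw [lt_div_iff₀ hlogP]; linarith
  rw [Lemma101.ftilde_eq_zero_of_ge hz.le]
  simp

/-! ## §3. The `n`-sum is `(log P₁)⁻¹ ×` the left side of Lemma 8.4 at `x = P₁/(dr)`, `μ = 6` -/

/-- `β₆ ∈ iℝ`: `conj β₆ = −β₆`. [cite: Zhang2022LandauSiegel, §2 (2.22)] -/
private theorem conj_beta6 (D : ℕ) : conj (beta6 D) = -beta6 D := by
  have e : beta6 D = ((3 * alpha D / 2 : ℝ) : ℂ) * I := by rw [beta6]; push_cast; ring
  rw [e, map_mul, Complex.conj_ofReal, Complex.conj_I]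
  ring

/-- `β_μ` at `μ = 6` is `β₆`. [cite: Zhang2022LandauSiegel, §2 (2.22)] -/
theorem betaMu_six (D : ℕ) : betaMu D 6 = beta6 D := by
  rw [betaMu, if_neg (by norm_num)]

/-- For `P^{0.5} ≤ dr`: `ϰ₂(drn) = 0` for every `n ≥ 1` (`drn ≥ P^{0.5} ≥ P₂`).
[cite: Zhang2022LandauSiegel, §10 p. 58] -/
theorem vk2_mul_eq_zero (hL : 0 ≤ ell D) {d r : ℕ} (hlo : bigP D ^ (0.5 : ℝ) ≤ ((d * r : ℕ) : ℝ))
    {n : ℕ} (hn : 1 ≤ n) : vk2 D (d * r * n) = 0 := by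
  rw [vk2, if_neg]
  rw [not_lt]
  calc Skeleton.P2 D ≤ bigP D ^ (0.5 : ℝ) := P2_le_rpow_half hL
    _ ≤ ((d * r : ℕ) : ℝ) := hlo
    _ ≤ ((d * r * n : ℕ) : ℝ) := by
        exact_mod_cast Nat.le_mul_of_pos_right _ hn

/-- For `P^{0.5} ≤ dr` and `n ≥ 1`, with `x = P₁/(dr)`:
`conj ϰ₁(drn) = [n < x]·(log(x/n)/log P₁)·(x/n)^{−β₆}`. [cite: Zhang2022LandauSiegel, §10 p. 58] -/
theorem conj_vk1_mul_eq (hL : 3 ≤ ell D) {d r : ℕ} (hd : 1 ≤ d) (hr : 1 ≤ r) {n : ℕ} (hn : 1 ≤ n) :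
    conj (vk1 D (d * r * n)) =
      if (n : ℝ) < Skeleton.P1 D / ((d * r : ℕ) : ℝ) then
        ((Real.log ((Skeleton.P1 D / ((d * r : ℕ) : ℝ)) / n) / Real.log (Skeleton.P1 D) : ℝ) : ℂ) *
          (((Skeleton.P1 D / ((d * r : ℕ) : ℝ)) / n : ℝ) : ℂ) ^ (-beta6 D)
      else 0 := by
  have hdr : (0 : ℝ) < ((d * r : ℕ) : ℝ) := by exact_mod_cast Nat.mul_pos hd hr
  have hn0 : (0 : ℝ) < n := by exact_mod_cast hn
  have hP1 : 0 < Skeleton.P1 D := Real.rpow_pos_of_pos (bigP_pos' D) _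
  have hlogP1 : Real.log (Skeleton.P1 D) ≠ 0 := by
    rw [Skeleton.P1, Real.log_rpow (bigP_pos' D), bigP, Real.log_exp]
    have : 0 < ell D := by linarith
    positivity
  have hcast : (((d * r * n : ℕ) : ℝ)) = ((d * r : ℕ) : ℝ) * n := by push_cast; ring
  have hiff : ((d * r * n : ℕ) : ℝ) < Skeleton.P1 D ↔ (n : ℝ) < Skeleton.P1 D / ((d * r : ℕ) : ℝ) := by
    rw [hcast, lt_div_iff₀ hdr, mul_comm]
  rw [vk1]
  by_cases h : (n : ℝ) < Skeleton.P1 D / ((d * r : ℕ) : ℝ)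
  · rw [if_pos (hiff.mpr h), if_pos h]
    have hxn : Skeleton.P1 D / ((d * r * n : ℕ) : ℝ) = (Skeleton.P1 D / ((d * r : ℕ) : ℝ)) / n := by
      rw [hcast, div_div]
    have hlog : 1 - Real.log ((d * r * n : ℕ) : ℝ) / Real.log (Skeleton.P1 D) =
        Real.log ((Skeleton.P1 D / ((d * r : ℕ) : ℝ)) / n) / Real.log (Skeleton.P1 D) := by
      rw [← hxn, Real.log_div hP1.ne' (by rw [hcast]; positivity)]
      field_simp
    rw [hlog, hxn, map_mul, Complex.conj_ofReal]
    congr 1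
    have hx0 : 0 < (Skeleton.P1 D / ((d * r : ℕ) : ℝ)) / n := by positivity
    have harg : (((Skeleton.P1 D / ((d * r : ℕ) : ℝ)) / n : ℝ) : ℂ).arg ≠ π := by
      rw [Complex.arg_ofReal_of_nonneg hx0.le]; exact Real.pi_ne_zero.symm
    have h1 := Complex.conj_cpow (((Skeleton.P1 D / ((d * r : ℕ) : ℝ)) / n : ℝ) : ℂ) (-beta6 D) harg
    rw [Complex.conj_ofReal, map_neg, conj_beta6, neg_neg] at h1
    -- `h1 : x ^ (-β₆) = conj (x ^ β₆)`
    exact h1.symm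
  · rw [if_neg (fun h' => h (hiff.mp h')), if_neg h, map_zero]

/-- **The `n`-sum of `S_j(𝐚₁₃,𝐚₂₁)`, middle range, IS Lemma 8.4's sum**: for `d, r ≥ 1` with
`P^{0.5} ≤ dr` and `𝓛 ≥ 3`, with `x = P₁/(dr)`,
`nSum21(d,r) = (log P₁)⁻¹ Σ_{n<x} χ(n)ξ₀ⱼ(n;d,r)n⁻¹(x/n)^{−β₆}log(x/n)` (only `dr ≥ P^{0.5}` is used:
it kills `ϰ₂` and puts `⌈x⌉ ≤ ⌈PT⁻²⌉`). [cite: Zhang2022LandauSiegel, §10 p. 58] -/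
theorem nSum21_eq (χ : DirichletCharacter ℂ D) (hL : 3 ≤ ell D) (j : ℕ) {d r : ℕ} (hd : 1 ≤ d)
    (hr : 1 ≤ r) (hlo : bigP D ^ (0.5 : ℝ) ≤ ((d * r : ℕ) : ℝ)) :
    nSum21 c' χ j d r = (1 / (Real.log (Skeleton.P1 D) : ℂ)) *
      ∑ n ∈ Finset.Ico 1 ⌈Skeleton.P1 D / ((d * r : ℕ) : ℝ)⌉₊,
        χ (n : ZMod D) * xiZero c' D j n d r / (n : ℂ) *
          (((Skeleton.P1 D / ((d * r : ℕ) : ℝ)) / n : ℝ) : ℂ) ^ (-betaMu D 6) *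
          (Real.log ((Skeleton.P1 D / ((d * r : ℕ) : ℝ)) / n) : ℂ) := by
  have hL0 : 0 ≤ ell D := by linarith
  have hdr : (0 : ℝ) < ((d * r : ℕ) : ℝ) := by exact_mod_cast Nat.mul_pos hd hr
  set x : ℝ := Skeleton.P1 D / ((d * r : ℕ) : ℝ) with hx
  -- the range `⌈x⌉ ≤ ⌈PT⁻²⌉`
  have hP4 : 0 ≤ bigP D ^ (0.004 : ℝ) := Real.rpow_nonneg (bigP_pos' D).le _
  have hxN : ⌈x⌉₊ ≤ Nsupp D := by
    refine Nat.ceil_mono ?_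
    have hx4 : x ≤ bigP D ^ (0.004 : ℝ) := by
      rw [hx, div_le_iff₀ hdr, Skeleton.P1]
      calc bigP D ^ (0.504 : ℝ) = bigP D ^ (0.004 : ℝ) * bigP D ^ (0.5 : ℝ) := by
            rw [← Real.rpow_add (bigP_pos' D)]; norm_num
        _ ≤ bigP D ^ (0.004 : ℝ) * ((d * r : ℕ) : ℝ) := by gcongr
    have hT : 0 < bigT D ^ 2 := pow_pos (Real.exp_pos _) 2
    rw [le_div_iff₀ hT]
    calc x * bigT D ^ 2 ≤ bigP D ^ (0.004 : ℝ) * bigT D ^ 2 := by gcongr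
      _ ≤ bigP D := by rw [mul_comm]; exact bigT_sq_mul_rpow_le' hL
  unfold nSum21
  -- termwise: `ϰ₂`-part vanishes, `conj ϰ₁` is the indicator times the printed profile
  have hterm : ∀ n ∈ Finset.Ico 1 (Nsupp D),
      χ (n : ZMod D) * (conj (vk1 D (d * r * n)) + conj iota2 * conj (vk2 D (d * r * n))) *
          xiZero c' D j n d r / (n : ℂ) =
        if n < ⌈x⌉₊ then (1 / (Real.log (Skeleton.P1 D) : ℂ)) *
          (χ (n : ZMod D) * xiZero c' D j n d r / (n : ℂ) * ((x / n : ℝ) : ℂ) ^ (-betaMu D 6) *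
            (Real.log (x / n) : ℂ)) else 0 := by
    intro n hn
    have hn1 : 1 ≤ n := (Finset.mem_Ico.mp hn).1
    rw [vk2_mul_eq_zero hL0 hlo hn1, map_zero, mul_zero, add_zero, conj_vk1_mul_eq hL hd hr hn1,
      betaMu_six, ← hx]
    have hiff : (n : ℝ) < x ↔ n < ⌈x⌉₊ := Nat.lt_ceil.symm
    by_cases h : (n : ℝ) < x
    · rw [if_pos h, if_pos (hiff.mp h)]
      push_cast
      ring
    · rw [if_neg h, if_neg (fun h' => h (hiff.mpr h'))]
      simp
  rw [Finset.sum_congr rfl hterm, ← Finset.sum_filter, Finset.Ico_filter_lt, min_eq_right hxN,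
    ← Finset.mul_sum]

/-! ## §4. "Substituting `n = dr`" and the collapse (8.10) -/

/-- The `(d,r)`-box sum over a `dr`-range equals the sum over `n` in the range of `Σ_{r∣n}` (the
box truncation `d, r < ⌈PT⁻²⌉` is vacuous once the range forces `n < ⌈PT⁻²⌉`).
[cite: Zhang2022LandauSiegel, §10 p. 58] -/
theorem drSum_eq_sum_divisors (χ : DirichletCharacter ℂ D) (j : ℕ) (M : ℕ → ℂ) (N : ℕ → ℕ → ℂ)
    {lo hi : ℝ} (hN : ∀ n : ℕ, lo ≤ (n : ℝ) ∧ (n : ℝ) < hi → n < Nsupp D) :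
    drSum c' χ j M N lo hi =
      ∑ n ∈ (Finset.Ico 1 (Nsupp D)).filter (fun n : ℕ => lo ≤ (n : ℝ) ∧ (n : ℝ) < hi),
        ∑ r ∈ n.divisors, drWeight c' χ j (n / r) r * M n * N (n / r) r := by
  unfold drSum
  rw [sum_box_ite_eq_sum_divisors (Nsupp D) (fun n : ℕ => lo ≤ (n : ℝ) ∧ (n : ℝ) < hi) hN
    (fun d r => drWeight c' χ j d r * M (d * r) * N d r)]
  refine Finset.sum_congr rfl fun n _ => Finset.sum_congr rfl fun r hr => ?_
  rw [Nat.div_mul_cancel (Nat.dvd_of_mem_divisors hr)]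

/-- **The collapse** `Σ_{r∣n} |χ(n/r)||μχ(r)|λ₀ⱼ(n)Π(n/r,r)/(nφ(r))·G = |χ(n)|λ₀ⱼ(n)φ(n)⁻¹·G` for a
real `χ` and `n ≥ 1` ((8.10): `Σ_{dr=n}|μ(r)|Π(d,r)/φ(r) = n/φ(n)`, the tree's `eq810_holds`).
[cite: Zhang2022LandauSiegel, §8 (8.10)] -/
theorem sum_divisors_drWeight_mul_PiW [NeZero D] (χ : DirichletCharacter ℂ D) (hq : χ.IsQuadratic)
    (j : ℕ) {n : ℕ} (hn : n ≠ 0) (G : ℂ) :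
    ∑ r ∈ n.divisors, drWeight c' χ j (n / r) r * PiW χ (n / r) r * G =
      (‖χ (n : ZMod D)‖ : ℂ) * lamZero c' D j n / (Nat.totient n : ℂ) * G := by
  have h810 := Section8FrontEnd810.eq810_holds D χ hq n hn
  have hterm : ∀ r ∈ n.divisors, drWeight c' χ j (n / r) r * PiW χ (n / r) r * G =
      ((‖χ (n : ZMod D)‖ : ℂ) * lamZero c' D j n / (n : ℂ) * G) *
        (if Squarefree r then (1 / (Nat.totient r : ℂ)) * PiW χ (n / r) r else 0) := by
    intro r hr
    have hrn : n / r * r = n := Nat.div_mul_cancel (Nat.dvd_of_mem_divisors hr)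
    unfold drWeight
    rw [norm_chi_mul_norm_moebius_chi χ (n / r) r, hrn]
    split_ifs with hsq
    · ring
    · simp
  rw [Finset.sum_congr rfl hterm, ← Finset.mul_sum, ← Finset.sum_filter, h810]
  have hn0 : (n : ℂ) ≠ 0 := by exact_mod_cast hn
  have hφ : (Nat.totient n : ℂ) ≠ 0 := by
    exact_mod_cast (Nat.totient_pos.mpr (Nat.pos_of_ne_zero hn)).ne'
  field_simp

/-- The index set of the middle range: `{1 ≤ n < ⌈PT⁻²⌉ : P^{0.5} ≤ n < P^{0.502}}` is
`{1 ≤ n < ⌈P^{0.502}⌉ : P^{0.5} ≤ n}` (the set `Typed.Sec10B.nAvg` sums over).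
[cite: Zhang2022LandauSiegel, §10 p. 58] -/
theorem filter_midRange_eq (hL : 3 ≤ ell D) :
    (Finset.Ico 1 (Nsupp D)).filter
        (fun n : ℕ => bigP D ^ (0.5 : ℝ) ≤ (n : ℝ) ∧ (n : ℝ) < bigP D ^ (0.502 : ℝ)) =
      (Finset.Ico 1 ⌈bigP D ^ (0.502 : ℝ)⌉₊).filter (fun n : ℕ => bigP D ^ (0.5 : ℝ) ≤ (n : ℝ)) := by
  ext n
  simp only [Finset.mem_filter, Finset.mem_Ico]
  constructor
  · rintro ⟨⟨h1, _⟩, hlo, hhi⟩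
    exact ⟨⟨h1, Nat.lt_ceil.mpr hhi⟩, hlo⟩
  · rintro ⟨⟨h1, h2⟩, hlo⟩
    have hhi : (n : ℝ) < bigP D ^ (0.502 : ℝ) := Nat.lt_ceil.mp h2
    exact ⟨⟨h1, lt_Nsupp_of_lt_rpow hL hhi⟩, hlo, hhi⟩

/-- `log P₁ = 0.504 log P`. [cite: Zhang2022LandauSiegel, §2 (2.21)] -/
private theorem log_P1 (D : ℕ) : Real.log (Skeleton.P1 D) = 0.504 * Real.log (bigP D) := by
  rw [Skeleton.P1, Real.log_rpow (bigP_pos' D)]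

/-- **The exact layer of `Z22:§10.u043` (first line).** For a real `χ`, `𝓛 ≥ 3` and any `j`:
(the `(d,r)`-sum over `P^{0.5} ≤ dr < P^{0.502}`) − (the printed main term of `Eq1043a`) EQUALS the
weighted sum, over `n` in the range and `r ∣ n`, of the deviations
`mSum·nSum − m₁(n)·(L′(1,χ)Π(n/r,r)𝔤_{j6}(P₁/n)/log P₁)`, `m₁(n) = 500L′(1,χ)/log P·(−1 − β_j log(n/P^{0.5}))`
(the main values of Lemmas 10.1 and 8.4). [cite: Zhang2022LandauSiegel, §10 p. 58] -/
theorem drSum_sub_main_eq [NeZero D] (χ : DirichletCharacter ℂ D) (hq : χ.IsQuadratic)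
    (hL : 3 ≤ ell D) (j : ℕ) :
    drSum c' χ j (mSum13 c' χ j) (nSum21 c' χ j) (bigP D ^ (0.5 : ℝ)) (bigP D ^ (0.502 : ℝ)) -
        500 * deriv χ.LFunction 1 ^ 2 / (0.504 * logP D ^ 2) *
          nAvg c' χ j (bigP D ^ (0.5 : ℝ)) (bigP D ^ (0.502 : ℝ)) (fun n =>
            (-1 - betaJ c' D j * (Real.log (n / bigP D ^ (0.5 : ℝ)) : ℂ)) *
              frakgW c' D j 6 (bigP D ^ (0.504 : ℝ) / n)) =
      ∑ n ∈ (Finset.Ico 1 (Nsupp D)).filter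
          (fun n : ℕ => bigP D ^ (0.5 : ℝ) ≤ (n : ℝ) ∧ (n : ℝ) < bigP D ^ (0.502 : ℝ)),
        ∑ r ∈ n.divisors, drWeight c' χ j (n / r) r *
          (mSum13 c' χ j n * nSum21 c' χ j (n / r) r -
            (500 * deriv χ.LFunction 1 / Real.log (bigP D) *
                (-1 - betaJ c' D j * (Real.log (n / bigP D ^ (0.5 : ℝ)) : ℂ))) *
              (deriv χ.LFunction 1 * PiW χ (n / r) r * frakgW c' D j 6 (Skeleton.P1 D / (n : ℝ)) /
                (Real.log (Skeleton.P1 D) : ℂ))) := by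
  have hlogP : Real.log (bigP D) ≠ 0 := by
    rw [bigP, Real.log_exp]; have : 0 < ell D := by linarith
    positivity
  have hlogP1 : (Real.log (Skeleton.P1 D) : ℂ) ≠ 0 := by
    rw [log_P1]; push_cast
    exact mul_ne_zero (by norm_num) (by exact_mod_cast hlogP)
  -- the `(d,r)`-sum re-indexed
  rw [drSum_eq_sum_divisors c' χ j _ _ (fun n hn => lt_Nsupp_of_lt_rpow hL hn.2)]
  -- the main term as the same double sum, via the collapse
  have hmain : nAvg c' χ j (bigP D ^ (0.5 : ℝ)) (bigP D ^ (0.502 : ℝ)) (fun n =>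
        (-1 - betaJ c' D j * (Real.log (n / bigP D ^ (0.5 : ℝ)) : ℂ)) *
          frakgW c' D j 6 (bigP D ^ (0.504 : ℝ) / n)) =
      ∑ n ∈ (Finset.Ico 1 (Nsupp D)).filter
          (fun n : ℕ => bigP D ^ (0.5 : ℝ) ≤ (n : ℝ) ∧ (n : ℝ) < bigP D ^ (0.502 : ℝ)),
        ∑ r ∈ n.divisors, drWeight c' χ j (n / r) r * PiW χ (n / r) r *
          ((-1 - betaJ c' D j * (Real.log (n / bigP D ^ (0.5 : ℝ)) : ℂ)) *
            frakgW c' D j 6 (bigP D ^ (0.504 : ℝ) / n)) := by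
    rw [nAvg, ← filter_midRange_eq hL]
    refine Finset.sum_congr rfl fun n hn => ?_
    have hn0 : n ≠ 0 := by
      have := (Finset.mem_Ico.mp (Finset.mem_filter.mp hn).1).1; omega
    rw [sum_divisors_drWeight_mul_PiW c' χ hq j hn0]
  rw [hmain, Finset.mul_sum, ← Finset.sum_sub_distrib]
  refine Finset.sum_congr rfl fun n hn => ?_
  rw [Finset.mul_sum, ← Finset.sum_sub_distrib]
  refine Finset.sum_congr rfl fun r hr => ?_
  have hP1n : Skeleton.P1 D / (n : ℝ) = bigP D ^ (0.504 : ℝ) / n := by rw [Skeleton.P1]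
  rw [hP1n, log_P1]
  push_cast
  field_simp

end Literature.NumberTheory.LFunctions.Zhang2022.Sj1321Mid
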